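import Mathlib
import Summits.Ventures.PercRepro2.SwOutCrossBaseBlueEdges
import Summits.Ventures.PercRepro2.SwOutCrossBaseEdgesM

/-!
# The cross base, for ANY cross graph: the blue edge set by duality, the leak (blind cell
PercRepro2, night-4 g25, 2026-08-28; proofs/NIGHT4-G25.md §3)

`SwOutCrossBaseBlueEdges` re-stated on the minimal record `fibKEEMin G`: `blueEdges_crossRealM`
(the blue edges of the blue cluster of `h` are `φX` of the blue atoms `EBFM`), `leakM_toGen_iff`
(the leak of the record's point is the red-side or the blue-side leak).  The dual lemmas
`redClassX_dualCross`, `φX_dualCross` are reused.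
-/

namespace Summit.Ventures.PercRepro2

namespace CrossArm

open Hull LocRows

variable {V E : Type*}

open scoped Classical

section BlueEdges

variable {ends : E → Sym2 V} {σ : Config E} {h u : V} {ι X κ : Type*} {U : ι → Set V}
  {p : X → V} {G : SimpleGraph X} {F : κ → Set V} [Fintype X] [DecidableEq X]
  [DecidableRel G.Adj] [Nonempty X] (hb : CrossBase ends σ h u U p G F)
include hb

omit hb in
omit [Fintype X] [DecidableEq X] [DecidableRel G.Adj] [Nonempty X] in
/-- The red atoms of the flipped point are the blue atoms of the point. -/
lemma ERFM_toGen_flipXG (q : PtXG ι κ X G) :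
    ERFM (fibKEEMin G) (toGen G (flipXG G q)) = EBFM (fibKEEMin G) (toGen G q) := rfl

omit [Fintype X] [DecidableEq X] [DecidableRel G.Adj] [Nonempty X] in
/-- **The blue edge-set form of the hull formula**: at a point without blue-side leak, the blue
edges of the blue cluster of `h` are `φX` of the blue atoms (edge atoms) of the point. -/
theorem CrossBase.blueEdges_crossRealM (hup : ∀ i, ∃ e, ends e = s(u, p i))
    (hcross : ∀ i j, G.Adj i j → ∃ e, ends e = s(p i, p j)) {q : PtXG ι κ X G}
    (hq : ¬ LeakBX G q) :
    blueEdges ends (crossReal ends u U p G F σ q) h =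
      φX ends σ h u U p G F (EBFM (fibKEEMin G) (toGen G q)) := by
  rw [blueEdges, hb.blue_crossReal, hb.dual.redEdges_crossRealM hup hcross hq, hb.φX_dualCross,
    ERFM_toGen_flipXG]

omit hb in
omit [Fintype X] [DecidableEq X] [DecidableRel G.Adj] [Nonempty X] in
/-- The leak of the generic point is the red-side or the blue-side leak of the point. -/
lemma leakM_toGen_iff (q : PtXG ι κ X G) :
    LeakM (fibKEEMin G) (toGen G q).2 ↔ LeakRX G q ∨ LeakBX G q := by
  simp only [LeakM, LeakRX, LeakBX, flipXG, toGen, fibKEEMin, leakKE, redUG, blueUG, flipAll,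
    decide_eq_true_eq, Bool.not_eq_true']

end BlueEdges

end CrossArm

end Summit.Ventures.PercRepro2
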